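import Summits.AtomisticToContinuum.Crystallization.Theses.ThreeConeCertificate
import Summits.AtomisticToContinuum.Crystallization.Theorems.ThreeConeCertificateExactCertificateNoGapIff
import Summits.AtomisticToContinuum.Crystallization.Theorems.ThreeConeCertificateExactCertificatePeriodicMinimum
import Summits.AtomisticToContinuum.Crystallization.Theorems.ThreeConeCertificateKeplerBound
import Summits.AtomisticToContinuum.Crystallization.Theorems.ThreeConeCertificateSlackToBulk
import Summits.AtomisticToContinuum.Crystallization.Theorems.ThreeConeCertificateDefectVanishCrystallizes
import Summits.AtomisticToContinuum.Crystallization.Theorems.ThreeConeCertificateTrialStateUpper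
import Summits.AtomisticToContinuum.Crystallization.Theorems.ThreeConeCertificateEnergeticHalf

/-!
# `ExactCertificate` (crux stmt-AtomisticToContinuum-11959) — the typed DECOMPOSITION and the route re-glue

Support file for the crux `Summit.AtomisticToContinuum.Crystallization.Theses.ThreeConeCertificate.ExactCertificate`
(line `closure-makes-nogap-exact`, lead c5).  It packages, over ROUTE-LEVEL declarations only, the two facts every
line lead of this crux (gen 0, gen 1, c1–c5) ended on:

1. **Typed split** `ExactCertificate_of_subs : NoGap → KeplerBound → ExactCertificate`, LOSSLESS
   (`ExactCertificate_iff_subs : ExactCertificate ↔ NoGap ∧ KeplerBound`), where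
   * `NoGap` is the registered stub `stub_noGap` of the line (signature verbatim, written inline below; it is the
     disprover's `SharpSplit` in `ε`-form: no duality gap for the three-cone programme at some finite range — by
     `…NoGap.noGap_iff_sharpSplit` — and it mentions no template `P`), and
   * `KeplerBound` is the route's own item stmt-AtomisticToContinuum-11961 (`↔` the line's second stub
     `stub_periodicMinimum` by `…stub_periodicMinimum_iff_keplerBound`, `↔ HasPeriodicGroundStateEnergy lennardJones 3`
     = conjunct (i) by `keplerBound_iff_hasPeriodicGroundStateEnergy`, `↔` the shared item 0627
     `CrysPeriodicMinAttained` by `keplerBound_iff_crysPeriodicMinAttained`): the attained periodic minimum of the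
     Lennard-Jones energy per particle in `ℝ³`, an open problem.
   This is exactly the glue a `route edit --split ExactCertificate --into NoGap KeplerBound --glue ExactCertificate_of_subs`
   needs; both pieces are genuine (neither is the crux reworded: `NoGap` drops attainment, `KeplerBound` drops the finite range,
   cf. `…ExactCertificateNegative` §3 `withoutFiniteRange_iff_keplerBound`).
2. **The route closes from `KeplerBound ∧ SlackRigidity` alone** (`crystallization_of_keplerBound_of_slackRigidity`): in the
   deciding theorem `ThreeConeCertificate.closes` the crux `ExactCertificate` is consumed only through
   `CertificateBound : ExactCertificate → KeplerBound`, while `KeplerBound` is itself a hypothesis of `closes`; every other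
   hypothesis (`CertificateBound`, `TrialStateUpper`, `EnergeticHalf`, `SlackToBulk`, `DefectVanishCrystallizes`, `Assembly`)
   is a landed tree theorem and `OnePercentCertificate`, `BulkDefectVanish` are unused.  So for THIS route the energetic content
   of the crux is `KeplerBound` (11961) and nothing else; `ExactCertificate` is one METHOD for it (strictly stronger by the
   finite-range half `NoGap`), not a load-bearing hypothesis of `closes`.

No new definition is introduced (the `NoGap` statement is spelled out in each signature).
-/

noncomputable section

namespace Summit.AtomisticToContinuum.Crystallization.Theorems.ThreeConeCertificateExactCertificate.Split

open Literature.MathematicalPhysics.StatisticalMechanics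
open Summit.AtomisticToContinuum.Crystallization.Theses.ThreeConeCertificate
open scoped BigOperators

/-- **The typed split of the crux, sufficiency direction (`<CruxDecl>_of_subs`).**
`NoGap → KeplerBound → ExactCertificate`: no three-cone duality gap at some finite range `ρ₀` (the registered
stub `stub_noGap`, verbatim) together with the Kepler bound (route item 11961) gives an exact finite-range
three-cone certificate.  Composition of the landed line theorems `…NoGap.exactCertificate_of_noGap_of_periodicMinimum`
(closure lemma at level `−e*` + weak duality) and `…stub_periodicMinimum_of_keplerBound`. [folklore] -/
theorem ExactCertificate_of_subs :
    (∃ ρ₀ : ℝ, ∀ ε : ℝ, 0 < ε → ∃ (Q : PeriodicConfiguration 3) (f : ℝ → ℝ),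
      (∀ (n : ℕ) (y : Fin n → EuclideanSpace ℝ (Fin 3)) (w : Fin n → ℝ),
        0 ≤ ∑ i, ∑ j, w i * w j * f (dist (y i) (y j))) ∧
      (∀ r : ℝ, ρ₀ ≤ r → 0 < r → f r ≤ lennardJones r) ∧
      f 0 + 2 * Q.energyPerParticle (fun r => if r < ρ₀ then f r else 0) +
          2 * Q.energyPerParticle (fun r => if r < ρ₀ then 0 else lennardJones r) ≤ ε ∧
      (∀ (N : ℕ) (x : Fin N → EuclideanSpace ℝ (Fin 3)), Function.Injective x →
        (N : ℝ) * (Q.energyPerParticle (fun r => if r < ρ₀ then lennardJones r - f r else 0) - ε) ≤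
          interactionEnergy (fun r => if r < ρ₀ then lennardJones r - f r else 0) x)) →
    Summit.AtomisticToContinuum.Crystallization.Theses.ThreeConeCertificate.KeplerBound →
    Summit.AtomisticToContinuum.Crystallization.Theses.ThreeConeCertificate.ExactCertificate :=
  fun hNoGap hKepler =>
    NoGap.exactCertificate_of_noGap_of_periodicMinimum hNoGap (stub_periodicMinimum_of_keplerBound hKepler)

/-- **The split is lossless: `ExactCertificate ↔ NoGap ∧ KeplerBound`** (necessity by the landed
`…Slackness.noGap_of_exactCertificate` and `Theorems.keplerBound_of_exactCertificate`).  The crux factors EXACTLY into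
"no three-cone duality gap at some finite range" (template-free) and the route's item 11961 (the attained
periodic Lennard-Jones minimum in `ℝ³`, conjunct (i) of the summit). [folklore] -/
theorem ExactCertificate_iff_subs :
    ExactCertificate ↔
      (∃ ρ₀ : ℝ, ∀ ε : ℝ, 0 < ε → ∃ (Q : PeriodicConfiguration 3) (f : ℝ → ℝ),
        (∀ (n : ℕ) (y : Fin n → EuclideanSpace ℝ (Fin 3)) (w : Fin n → ℝ),
          0 ≤ ∑ i, ∑ j, w i * w j * f (dist (y i) (y j))) ∧
        (∀ r : ℝ, ρ₀ ≤ r → 0 < r → f r ≤ lennardJones r) ∧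
        f 0 + 2 * Q.energyPerParticle (fun r => if r < ρ₀ then f r else 0) +
            2 * Q.energyPerParticle (fun r => if r < ρ₀ then 0 else lennardJones r) ≤ ε ∧
        (∀ (N : ℕ) (x : Fin N → EuclideanSpace ℝ (Fin 3)), Function.Injective x →
          (N : ℝ) * (Q.energyPerParticle (fun r => if r < ρ₀ then lennardJones r - f r else 0) - ε) ≤
            interactionEnergy (fun r => if r < ρ₀ then lennardJones r - f r else 0) x)) ∧
      KeplerBound :=
  ⟨fun h => ⟨Slackness.noGap_of_exactCertificate h,
      Summit.AtomisticToContinuum.Crystallization.Theorems.keplerBound_of_exactCertificate h⟩,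
    fun h => ExactCertificate_of_subs h.1 h.2⟩

/-- **Given the Kepler bound, the crux IS the no-gap statement** (`KeplerBound → (ExactCertificate ↔ NoGap)`):
once item 11961 lands, what remains of the crux is exactly finite-range sharpness of the three-cone bound. [folklore] -/
theorem exactCertificate_iff_noGap_of_keplerBound (hKepler : KeplerBound) :
    ExactCertificate ↔
      ∃ ρ₀ : ℝ, ∀ ε : ℝ, 0 < ε → ∃ (Q : PeriodicConfiguration 3) (f : ℝ → ℝ),
        (∀ (n : ℕ) (y : Fin n → EuclideanSpace ℝ (Fin 3)) (w : Fin n → ℝ),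
          0 ≤ ∑ i, ∑ j, w i * w j * f (dist (y i) (y j))) ∧
        (∀ r : ℝ, ρ₀ ≤ r → 0 < r → f r ≤ lennardJones r) ∧
        f 0 + 2 * Q.energyPerParticle (fun r => if r < ρ₀ then f r else 0) +
            2 * Q.energyPerParticle (fun r => if r < ρ₀ then 0 else lennardJones r) ≤ ε ∧
        (∀ (N : ℕ) (x : Fin N → EuclideanSpace ℝ (Fin 3)), Function.Injective x →
          (N : ℝ) * (Q.energyPerParticle (fun r => if r < ρ₀ then lennardJones r - f r else 0) - ε) ≤
            interactionEnergy (fun r => if r < ρ₀ then lennardJones r - f r else 0) x) :=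
  ⟨Slackness.noGap_of_exactCertificate, fun h => ExactCertificate_of_subs h hKepler⟩

/-- **The route closes from `KeplerBound ∧ SlackRigidity` alone.**  The deciding theorem
`ThreeConeCertificate.closes` with its idle hypotheses dropped and its provable ones discharged by the landed
tree theorems (`trialStateUpper_proof`, `energeticHalf_proof`, `slackToBulk_proof`,
`defectVanishCrystallizes_proof`, `LennardJonesMinimalDistance_holds`): conjunct (i) is
`EnergeticHalf KeplerBound TrialStateUpper`, conjunct (ii) is `DefectVanishCrystallizes (SlackToBulk SlackRigidity) δ_LJ`.
In particular `ExactCertificate` (11959) enters `closes` only as a sufficient condition for `KeplerBound` (11961). [folklore] -/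
theorem crystallization_of_keplerBound_of_slackRigidity (hKepler : KeplerBound) (hRigid : SlackRigidity) :
    _root_.Crystallization :=
  ⟨Summit.AtomisticToContinuum.Crystallization.Theorems.energeticHalf_proof hKepler
      Summit.AtomisticToContinuum.Crystallization.Theorems.trialStateUpper_proof,
    Summit.AtomisticToContinuum.Crystallization.Theorems.ThreeConeCertificateDefectVanishCrystallizes.defectVanishCrystallizes_proof
      (Summit.AtomisticToContinuum.Crystallization.Theorems.slackToBulk_proof hRigid)
      Literature.MathematicalPhysics.StatisticalMechanics.LennardJonesMinimalDistance_holds⟩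

/-- **Hence the route also closes from the two pieces of the split plus `SlackRigidity`** — and the `NoGap`
piece is not used: a formal witness that the finite-range half of the crux carries no weight in `closes`. [folklore] -/
theorem crystallization_of_exactCertificate_of_slackRigidity (hExact : ExactCertificate)
    (hRigid : SlackRigidity) : _root_.Crystallization :=
  crystallization_of_keplerBound_of_slackRigidity
    (Summit.AtomisticToContinuum.Crystallization.Theorems.keplerBound_of_exactCertificate hExact) hRigid

end Summit.AtomisticToContinuum.Crystallization.Theorems.ThreeConeCertificateExactCertificate.Split

end
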